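import Summits.SmoothPoincare4.SmoothPoincare4.Theses.EntropyRung
import Summits.SmoothPoincare4.SmoothPoincare4.Theses.WeylBudget
import Summits.SmoothPoincare4.SmoothPoincare4.Theorems.EntropyRungMargerinRailsDefs
import Summits.SmoothPoincare4.SmoothPoincare4.Theorems.EntropyRungChangGurskyYangStubMargerinPolynomial
import Summits.SmoothPoincare4.SmoothPoincare4.Theorems.EntropyRungChangGurskyYangStubInitialFit
import Summits.SmoothPoincare4.SmoothPoincare4.Theorems.EntropyRungChangGurskyYangStubPinchingPreserved
import Summits.SmoothPoincare4.SmoothPoincare4.Theorems.EntropyRungChangGurskyYangStubPinchedFlowConvergence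
import Summits.SmoothPoincare4.SmoothPoincare4.Theorems.EntropyRungChangGurskyYangStubThm14Psc
import Literature.Geometry.Riemannian.ChangGurskyYangEuler
import Literature.Geometry.Riemannian.ChernGaussBonnetFour
import Literature.Geometry.Riemannian.ChangGurskyYangTheorem14
import Literature.Geometry.Riemannian.HamiltonConvergenceCriterion
import Literature.Geometry.Riemannian.HamiltonPCOClassificationKillingHopf
import HarnessLib

/-!
# Crux `EntropyRung.ChangGurskyYang` (item stmt-SmoothPoincare4-10834) REDUCED, kernel-checked, to three
# classical named facts — line `margerin-cone-hamilton-rails`, lead assembly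

The crux is VERBATIM the named fact `changGurskyYang_sphere_four` (Chang–Gursky–Yang 2003, Thm. A,
simply connected `scal > 0` case): a closed simply connected smooth 4-manifold carrying a `C^∞`
Riemannian metric with `R > 0` and `∫|W|² dV < 32π²` is diffeomorphic to `S⁴`. Along the line
`margerin-cone-hamilton-rails` (skeleton `Cruxes/ChangGurskyYang/Lines/margerin-cone-hamilton-rails.lean`)
its six registered stubs are now: STUB 1 `stub_margerinPolynomial` (Margerin's polynomial inequality in
margin form — PROVED, `…StubMargerinPolynomial`), STUB 2 `stub_initialFit` (PROVED, `…StubInitialFit`),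
STUB 3 `stub_pinchingPreserved` (PROVED via the tree's tensor maximum principle
`hamilton_maximumPrinciple_curvatureODE_holds`, `…StubPinchingPreserved`), STUB 4
`stub_pinchedFlowConvergence` (closed MODULO Hamilton 1986 §5.2, `…StubPinchedFlowConvergence`), STUB 5
`stub_chernGaussBonnetFour` (= the named fact `chernGaussBonnet_four`), STUB 6 `stub_thm14Psc` (closed
MODULO CGY 2003 Thm. 1.4, `…StubThm14Psc`). This file composes them:

* `margerin_theorem_of_convergenceCriterion` — **Margerin 1998, Thm. 1** (closed connected `M⁴`, `R > 0`,
  weak pinching `WP < 1/6` ⇒ `M ≅ S⁴` or `M` is a standard `ℝP⁴`) **modulo Hamilton's convergence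
  criterion** `hamilton_convergenceCriterion_four` only: the algebra (Prop. 4), the initial fit, the flow
  transfer and Killing–Hopf are theorems of the tree;
* `ChangGurskyYang_of_classicalFacts` — **the crux from exactly three named classical facts**:
  `chernGaussBonnet_four` (Chern–Gauss–Bonnet in dimension 4, Besse 6.31), `changGurskyYang_theorem14_four`
  (CGY 2003 Thm. 1.4, `α = 1`, connected), `hamilton_convergenceCriterion_four` (Hamilton 1986 §5.2);
  `ChangGurskyYang_weylBudget_of_classicalFacts` is the same for the item's second route decl.

The glue is the skeleton's `margerin_of_stubs` / `ChangGurskyYang_of_hypotheses` (CGY 2003 §2, p. 121,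
line by line), specialised to the landed stubs. It is a CONDITIONAL closing of the item (the gate records a
conditional-result; the item closes when the three facts are discharged).

References: [ChangGurskyYang2003] Thm. A, Thm. 1.4, §2; [Margerin1998] Thm. 1, Prop. 4; [Hamilton1986]
§4 Thm. 4.3, §5 (5.2), Thm. 1.1; [Besse1987] 6.31; [Lee2018] Thm. 12.4.
-/

noncomputable section

-- every `Summit.SmoothPoincare4.SmoothPoincare4.…` name repeats the summit = sub-problem segment (D-0017 layout)
set_option linter.dupNamespace false

open Set Function Module
open scoped Manifold ContDiff Matrix BigOperators Topology ENNReal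

namespace Summit.SmoothPoincare4.SmoothPoincare4.Theorems.MargerinRails

open Summit.SmoothPoincare4.SmoothPoincare4.Theses.EntropyRung (ChangGurskyYang)
open Literature.Geometry.Riemannian Literature.Geometry.Riemannian.HamiltonODE
open Literature.Geometry.Lorentzian Literature.Geometry.Lorentzian.PseudoRiemannianMetric
open Literature.Topology.FourManifolds

/-- **Margerin 1998, Thm. 1, modulo Hamilton's convergence criterion.** On a closed connected smooth
4-manifold, a `C^∞` Riemannian metric with `R > 0` and weak pinching `WP = (|W|² + 2|E|²)/R² < 1/6`
pointwise forces `M ≅ S⁴` or `M` a standard `ℝP⁴` — GIVEN Hamilton 1986 §5.2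
(`hamilton_convergenceCriterion_four`). Proof: initial fit (`stub_initialFit`) into
`Z = pinchingSet m c K (σ/2)` with the margin `σ = σ(c)` of Margerin's polynomial inequality
(`stub_margerinPolynomial`); every Ricci flow from `g` stays in `Z` (`stub_pinchingPreserved`, tensor
maximum principle); the convergence criterion gives constant curvature `k > 0`
(`stub_pinchedFlowConvergence_of_convergenceCriterion`); Killing–Hopf (`killingHopf_quotient_four`) and the
classification of free orthogonal quotients of `S⁴` (PROVED) finish.
[cite: Margerin1998, Thm. 1 (p. 21)] [cite: Hamilton1986, §5, 5.2 (p. 164)] [cite: Lee2018, Thm. 12.4, Cor. 12.5] -/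
theorem margerin_theorem_of_convergenceCriterion : hamilton_convergenceCriterion_four →
    ∀ (M : Type) [TopologicalSpace M] [T2Space M] [SecondCountableTopology M]
      [ChartedSpace (EuclideanSpace ℝ (Fin 4)) M] [IsManifold (𝓡 4) ∞ M] [CompactSpace M]
      [ConnectedSpace M]
      (g : PseudoRiemannianMetric (𝓡 4) ∞ (EuclideanSpace ℝ (Fin 4)) (TangentSpace (𝓡 4) : M → Type _))
      [g.HasLeviCivita], g.IsRiemannian → (∀ x, 0 < g.scalarCurvature x) →
      (∀ x, g.weakPinching x < 1 / 6) →
      Nonempty (M ≃ₘ⟮𝓡 4, 𝓡 4⟯ Metric.sphere (0 : EuclideanSpace ℝ (Fin 5)) 1) ∨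
        IsRealProjectiveSpace 4 M := by
  intro h52 M _ _ _ _ _ _ _ g _ hg hR hWP
  -- STUB 2: initial fit `m, c`, and for each `τ` a `K`
  obtain ⟨m, c, hm, hc0, hc, hfit⟩ := stub_initialFit M g hg hR hWP
  -- STUB 1: the margin `σ = σ(c)`; the line runs with `τ = σ/2 < σ`
  obtain ⟨σ, hσ0, hσ1, hpoly⟩ := stub_margerinPolynomial c hc0.le hc
  have hτ0 : 0 < σ / 2 := by positivity
  have hτσ : σ / 2 < σ := by linarith
  have hτ1 : σ / 2 ≤ 1 := by linarith
  obtain ⟨K, hK, hfitK⟩ := hfit (σ / 2) hτ0.le hτ1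
  -- STUB 3: every Ricci flow of Riemannian metrics starting at `g` stays in `Z = pinchingSet m c K (σ/2)`
  have hpres : ∀ (T : ℝ)
      (gt : ℝ → PseudoRiemannianMetric (𝓡 4) ∞ (EuclideanSpace ℝ (Fin 4))
        (TangentSpace (𝓡 4) : M → Type _))
      (cov : ℝ → CovariantDerivative (𝓡 4) (EuclideanSpace ℝ (Fin 4))
        (TangentSpace (𝓡 4) : M → Type _)),
      IsRicciFlow gt cov (Ico 0 T) → (∀ t ∈ Ico 0 T, (gt t).IsRiemannian) → gt 0 = g →
      ∀ t ∈ Ico 0 T, ∀ (x : M) (e : Fin 4 → TangentSpace (𝓡 4) x),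
        (gt t).IsOrthonormalFrame x e →
          ((gt t).blockA (cov t) x e, (gt t).blockB (cov t) x e, (gt t).blockC (cov t) x e) ∈
            pinchingSet m c K (σ / 2) := by
    intro T gt cov hflow hRiem h0 t ht x e he
    have hT : (0 : ℝ) ∈ Ico 0 T := ⟨le_rfl, lt_of_le_of_lt ht.1 ht.2⟩
    have hLC : (gt 0).IsLeviCivita (cov 0) := hflow.isLeviCivita 0 hT
    refine stub_pinchingPreserved m c K σ (σ / 2) hm hc0 hc hK hτ0 hτσ hσ1 hpoly M T gt cov hflow hRiem
      ?_ t ht x e he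
    intro y f hf
    subst h0
    exact hfitK (cov 0) hLC y f hf
  -- STUB 4 (modulo Hamilton 5.2): a metric of constant sectional curvature `k > 0` on `M`
  obtain ⟨k, g', hk, hg', hconst⟩ :=
    stub_pinchedFlowConvergence_of_convergenceCriterion h52 M g m c K (σ / 2) hg hm hc0 hc hK hτ0 hτ1
      hfitK hpres
  -- Killing–Hopf (PROVED) and the classification of free orthogonal quotients of `S⁴` (PROVED)
  obtain ⟨Γ, q, hfree, hq, hsurj, hfib⟩ := killingHopf_quotient_four M k g' hk hg' hconst
  exact nonempty_diffeomorph_or_isRealProjectiveSpace_of_orthogonal_quotient ⟨2, rfl⟩ hfree hq hsurj hfib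

/-- **The crux `EntropyRung.ChangGurskyYang` (CGY 2003, Thm. A, simply connected psc case) from three
named classical facts**: Chern–Gauss–Bonnet in dimension four (`chernGaussBonnet_four`), CGY 2003
Thm. 1.4 for connected closed 4-manifolds (`changGurskyYang_theorem14_four`), and Hamilton 1986 §5.2
(`hamilton_convergenceCriterion_four`). Proof = CGY 2003 §2 (p. 121) line by line: `(0.3) ⇒ (1.2)` by
Chern–Gauss–Bonnet and `χ(M) ≥ 2` (`quarter_weylEnergy_lt_of_chernGaussBonnet`, PROVED); Thm. 1.4 in the
connected psc shape (`stub_thm14Psc_of_theorem14`) gives a conformal `g'` with `R > 0` and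
`¼|W|² < σ₂(A)` pointwise; "rearranging terms" (`weakPinching_lt_of_sigma2WeylSchouten_gt`, PROVED) gives
`WP < 1/6`; Margerin's theorem modulo 5.2 (`margerin_theorem_of_convergenceCriterion`) gives
`S⁴ ∨ ℝP⁴`; `π₁ = 1` discards `ℝP⁴` (PROVED). [cite: ChangGurskyYang2003, §2, p. 121]
[cite: Margerin1998, Thm. 1] [cite: Hamilton1986, §5, 5.2] [cite: Besse1987, 6.31] -/
theorem ChangGurskyYang_of_classicalFacts : chernGaussBonnet_four → changGurskyYang_theorem14_four →
    hamilton_convergenceCriterion_four → ChangGurskyYang := by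
  intro hCGB h14 h52
  rintro M _ _ _ _ _ _ _ ⟨g, _, hgR, hscal, hW⟩
  letI : MeasurableSpace M := borel M
  haveI : BorelSpace M := ⟨rfl⟩
  have hE : finrank ℝ (EuclideanSpace ℝ (Fin 4)) = 4 := finrank_euclideanSpace_fin
  -- (0.3) ⇒ (1.2): Chern–Gauss–Bonnet and `χ(M) ≥ 2`
  have h12 : 1 / 4 * g.weylEnergy.toReal < g.sigma2WeylSchoutenIntegral :=
    quarter_weylEnergy_lt_of_chernGaussBonnet g hgR (hCGB M g hgR) hW
  -- Thm. 1.4, connected psc shape (STUB 6 modulo the fact)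
  obtain ⟨g', _, hg'R, -, hscal', hpt⟩ := stub_thm14Psc_of_theorem14 h14 M g hgR hscal h12
  have hpos' : ∀ (x : M) (v : TangentSpace (𝓡 4) x), v ≠ 0 → 0 < g'.val x v v :=
    fun x v hv ↦ hg'R x v hv
  -- "rearranging terms": `WP < 1/6` pointwise
  have hWP : ∀ x, g'.weakPinching x < 1 / 6 := fun x ↦
    g'.weakPinching_lt_of_sigma2WeylSchouten_gt (WithTop.coe_le_coe.mpr le_top) hE (hpos' x) (hpt x)
  -- Margerin (modulo 5.2): `S⁴ ∨ ℝP⁴`; `π₁ = 1` excludes `ℝP⁴`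
  rcases margerin_theorem_of_convergenceCriterion h52 M g' hg'R hscal' hWP with h | h
  · exact h
  · exact absurd ‹SimplyConnectedSpace M› (h.not_simplyConnectedSpace (by norm_num))

/-- The same reduction for the item's second route decl `WeylBudget.ChangGurskyYang` (the identical
proposition, `Iff.rfl`). [cite: ChangGurskyYang2003, Thm. A] -/
theorem ChangGurskyYang_weylBudget_of_classicalFacts : chernGaussBonnet_four →
    changGurskyYang_theorem14_four → hamilton_convergenceCriterion_four →
    Summit.SmoothPoincare4.SmoothPoincare4.Theses.WeylBudget.ChangGurskyYang :=
  ChangGurskyYang_of_classicalFacts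

end Summit.SmoothPoincare4.SmoothPoincare4.Theorems.MargerinRails

end
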